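import Summits.BirchSwinnertonDyer.BirchSwinnertonDyer.Theorems.UniversalToricDescentEisensteinCorankReadout
import Literature.NumberTheory.EllipticCurves.IwasawaSelmerDualEisensteinQuotientProofs
import Literature.NumberTheory.EllipticCurves.IwasawaEulerCharDualityProofs
import HarnessLib

/-!
# Route UniversalToricDescent — the RANK READOUT at Howard's Eisenstein primes, dual half:
# «`#{s ∈ Sel_∞ : ψ_m s = 0, p^k s = 0} ≤ C · p^{k r}` for all `k` ⟹ `rank_{ℤ_p} X/q_m X ≤ r`»
# (conjunct (H-ii) `hrank` of the port stub `stub_howardOutputsOfFamily`, line `beta-road` v9 on crux `TwinAlgMuZeroAtThree`, stmt-BirchSwinnertonDyer-24737)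

Width prover `bsd-wall-utd-p1-w2` g11 under lead `bsd-wall-utd-p1` g23/g24 (`--supports stmt-BirchSwinnertonDyer-24737`, helper). THEOREMS
ONLY (no definition, no named fact, no `sorry`); pure algebra plus the tree's Pontryagin dictionary; nothing arithmetic is asserted; BSD is not
proved by any of this; 24737 stays OPEN.

WHAT. Sequel of `…EisensteinCorankReadout` (p749164: `λ(N) ≤ r` from `#(N ⧸ p^k N) ≤ C p^{kr}`; `#(Φ_m/S_m)[p^k] = p^{km}`). Here the DUAL side:
* §1 `moduleFinite_padicInt_quotient_X_pow_add_C` — `X/q_m X` is finitely generated over `ℤ_p` for `X` finitely generated over `Λ` (`Λ/(q_m)` is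
  `ℤ_p`-free of rank `m`, p748126).
* §2 **`lambdaInvariant_quotSMulTop_le_of_dual`** — for ANY Pontryagin-dual pair `toDual : X ≅ Hom(S, ℚ/ℤ)` over `Λ` in which `q_m = T^m + p`
  acts as the transpose of an endomorphism `ψ` of `S` (cell x9's `PontryaginCard` setting): if `#{s ∈ ker ψ : p^k s = 0} ≤ C · p^{k r}` for
  every `k`, then `λ(X/q_m X) = rank_{ℤ_p} X/q_m X ≤ r`. Proof: `X/q_m X ≃ Hom(ker ψ, ℚ/ℤ)` and `(X/q_m X)/p^k ≃ Hom((ker ψ)[p^k], ℚ/ℤ)`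
  (x9's `exists_quotSMulTop_addEquiv_characterModule_ker`, twice), `#Hom(A, ℚ/ℤ) = #A` for finite `A`, then p749164.
* §3 **`lambdaInvariant_quotient_qm_le_of_natCard_le`** — the `SelmerDualData` instance: for an elliptic curve over a number field, a prime `p`,
  a `ℤ_p`-extension `κ`, any `γ`, any dual datum `D` with `X = D.X` finitely generated, `ψ_m = (conj_γ − 1)^m + p` on `Sel_∞ = Sel_{p^∞}(E/K_∞)`
  (x9's `SelmerDualData.toDual_qm_smul`): **`(∀ k, #{s ∈ Sel_∞ : ψ_m s = 0 ∧ p^k s = 0} ≤ C·p^{kr}) ⟹ lambdaInvariant p (X ⧸ q_m X) ≤ r`** —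
  so (H-ii) at `q_m` is the COUNT `#Sel_∞[ψ_m, p^k] ≤ C · p^{km}`, which Howard's Thm. 1.6.1 (ii) (`H¹_𝓕(K, A_m) ≅ Φ_m/S_m ⊕ M ⊕ M`,
  `#(Φ_m/S_m)[p^k] = p^{km}` by p749164) plus the discrete readout `ι₀` with finite index (x10b currency (hSel)/(hidx)) deliver.

References: [Howard2004HeegnerKolyvagin] Thm. 1.6.1, Lemma 2.2.7, proof of Thm. 2.2.10; [GreenbergLNM1716] §4 p. 98 (`X/θX` dual to `Sel[θ]`);
[Washington1997] §13.2.
-/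

set_option linter.dupNamespace false
set_option autoImplicit false

noncomputable section

open scoped Classical

namespace Summit.BirchSwinnertonDyer.BirchSwinnertonDyer.Theorems.UniversalToricDescentEisensteinCorankReadoutDual

open Literature.NumberTheory.EllipticCurves Literature.NumberTheory.EllipticCurves.IwasawaAlgebra
  Literature.NumberTheory.EllipticCurves.PontryaginCard
  Summit.BirchSwinnertonDyer.BirchSwinnertonDyer.Theorems.UniversalToricDescentEisensteinSpecializationRank
  Summit.BirchSwinnertonDyer.BirchSwinnertonDyer.Theorems.UniversalToricDescentEisensteinCorankReadout

universe v w

variable {p : ℕ} [hp : Fact p.Prime]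

/-! ## §1 `X/q_m X` is finitely generated over `ℤ_p` -/

/-- **`X/q_m X` is a finitely generated `ℤ_p`-module** for `X` finitely generated over `Λ` (with its compatible `ℤ_p`-structure): it is a
finitely generated module over `S_m = Λ/(q_m)`, which is `ℤ_p`-free of rank `m` (`m ≥ 1`). [cite: Washington1997, Prop. 13.8] -/
theorem moduleFinite_padicInt_quotient_X_pow_add_C {X : Type v} [AddCommGroup X] [Module (IwasawaAlgebra p) X]
    [Module.Finite (IwasawaAlgebra p) X] [Module ℤ_[p] X] [IsScalarTower ℤ_[p] (IwasawaAlgebra p) X] {m : ℕ} (hm : 1 ≤ m) :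
    Module.Finite ℤ_[p] (X ⧸ ((Ideal.span {(PowerSeries.X ^ m + PowerSeries.C (p : ℤ_[p]) : IwasawaAlgebra p)} :
      Ideal (IwasawaAlgebra p)) • (⊤ : Submodule (IwasawaAlgebra p) X))) := by
  set I : Ideal (IwasawaAlgebra p) := Ideal.span {(PowerSeries.X ^ m + PowerSeries.C (p : ℤ_[p]) : IwasawaAlgebra p)}
    with hI
  set N := X ⧸ (I • (⊤ : Submodule (IwasawaAlgebra p) X)) with hN
  have htors : Module.IsTorsionBySet (IwasawaAlgebra p) N ↑I := by
    rintro x ⟨a, ha⟩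
    induction x using Submodule.Quotient.induction_on with
    | H x =>
      change a • Submodule.Quotient.mk x = (0 : N)
      rw [← Submodule.Quotient.mk_smul, Submodule.Quotient.mk_eq_zero]
      exact Submodule.smul_mem_smul ha Submodule.mem_top
  letI := htors.module
  haveI : IsScalarTower (IwasawaAlgebra p) (IwasawaAlgebra p ⧸ I) N := htors.isScalarTower
  haveI : IsScalarTower ℤ_[p] (IwasawaAlgebra p ⧸ I) N := htors.isScalarTower
  haveI : Module.Finite (IwasawaAlgebra p ⧸ I) N := Module.Finite.of_restrictScalars_finite (IwasawaAlgebra p) _ _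
  obtain ⟨-, hfin, -⟩ := free_finrank_quotient_X_pow_add_C (p := p) hm
  haveI : Module.Finite ℤ_[p] (IwasawaAlgebra p ⧸ I) := hfin
  exact Module.Finite.trans (IwasawaAlgebra p ⧸ I) N

/-! ## §2 The dual readout: `#(ker ψ)[p^k] ≤ C p^{kr}` ⟹ `λ(X/q_m X) ≤ r` -/

/-- **The rank readout through a Pontryagin-dual pair.** `X` finitely generated over `Λ`; `toDual : X →+ Hom(S, ℚ/ℤ)` bijective with
`q_m = T^m + p` (`m ≥ 1`) acting as the transpose of `ψ : S →+ S` (`toDual (q_m • x) s = toDual x (ψ s)`). If `{s ∈ ker ψ : p^k s = 0}` is finite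
of cardinality `≤ C · p^{k r}` for every `k`, then `λ(X/q_m X) ≤ r`: `X/q_m X ≃ Hom(ker ψ, ℚ/ℤ)` and `(X/q_m X)/p^k ≃ Hom((ker ψ)[p^k], ℚ/ℤ)`
(the tree's `exists_quotSMulTop_addEquiv_characterModule_ker`, applied to `q_m` and then to `p^k`), `#Hom(A, ℚ/ℤ) = #A`, and
`lambdaInvariant_le_of_natCard_quotient_pow_le_lambda`. [cite: GreenbergLNM1716, §4 p. 98] [cite: Howard2004HeegnerKolyvagin, Lemma 2.2.7]
[cite: Washington1997, §13.2] -/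
theorem lambdaInvariant_quotSMulTop_le_of_dual {X : Type v} [AddCommGroup X] [Module (IwasawaAlgebra p) X]
    [Module.Finite (IwasawaAlgebra p) X] {S : Type w} [AddCommGroup S]
    (toDual : X →+ CharacterModule S) (hbij : Function.Bijective toDual) {m : ℕ} (hm : 1 ≤ m) (ψ : S →+ S)
    (hq : ∀ (x : X) (s : S),
      toDual ((PowerSeries.X ^ m + PowerSeries.C (p : ℤ_[p]) : IwasawaAlgebra p) • x) s = toDual x (ψ s))
    (r C : ℕ) (hcount : ∀ k : ℕ, Finite {s : ψ.ker // p ^ k • s = 0} ∧ Nat.card {s : ψ.ker // p ^ k • s = 0} ≤ C * p ^ (k * r)) :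
    lambdaInvariant p (X ⧸ ((Ideal.span {(PowerSeries.X ^ m + PowerSeries.C (p : ℤ_[p]) : IwasawaAlgebra p)} :
      Ideal (IwasawaAlgebra p)) • (⊤ : Submodule (IwasawaAlgebra p) X))) ≤ r := by
  -- the `ℤ_p`-structure of `X` (definitionally that of `RestrictScalars ℤ_p Λ X`) and of the quotient
  letI : Module ℤ_[p] X := Module.compHom X (algebraMap ℤ_[p] (IwasawaAlgebra p))
  haveI : IsScalarTower ℤ_[p] (IwasawaAlgebra p) X := IsScalarTower.of_compHom _ _ _
  set q : IwasawaAlgebra p := PowerSeries.X ^ m + PowerSeries.C (p : ℤ_[p]) with hqdef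
  set N := X ⧸ ((Ideal.span {q} : Ideal (IwasawaAlgebra p)) • (⊤ : Submodule (IwasawaAlgebra p) X)) with hN
  haveI : Module.Finite ℤ_[p] N := moduleFinite_padicInt_quotient_X_pow_add_C (p := p) (X := X) hm
  refine lambdaInvariant_le_of_natCard_quotient_pow_le_lambda p N C r fun k ↦ ?_
  -- first dualisation: `N ≃ Hom(ker ψ, ℚ/ℤ)`
  obtain ⟨Ψ, hΨ⟩ := exists_quotSMulTop_addEquiv_characterModule_ker toDual hbij q ψ hq
  -- second dualisation at `p^k`: `(p^k : Λ)` acts on `N` as the transpose of `p^k` on `ker ψ`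
  let ψ' : ψ.ker →+ ψ.ker := DistribSMul.toAddMonoidHom ψ.ker (p ^ k)
  have hψ' : ∀ a : ψ.ker, ψ' a = (p ^ k : ℕ) • a := fun a ↦ rfl
  have hq' : ∀ (n : N) (a : ψ.ker),
      Ψ.toAddMonoidHom (((p : IwasawaAlgebra p)) ^ k • n) a = Ψ.toAddMonoidHom n (ψ' a) := by
    intro n a
    show Ψ (((p : IwasawaAlgebra p)) ^ k • n) a = Ψ n ((p ^ k : ℕ) • a)
    rw [← Nat.cast_pow, Nat.cast_smul_eq_nsmul, map_nsmul, map_nsmul]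
    rfl
  obtain ⟨Ψ', -⟩ := exists_quotSMulTop_addEquiv_characterModule_ker Ψ.toAddMonoidHom Ψ.bijective
    (((p : IwasawaAlgebra p)) ^ k) ψ' hq'
  -- `ker ψ' = (ker ψ)[p^k]`
  have e1 : {s : ψ.ker // p ^ k • s = 0} ≃ ψ'.ker :=
    Equiv.subtypeEquivRight fun a ↦ by rw [AddMonoidHom.mem_ker, hψ']
  obtain ⟨hfin, hle⟩ := hcount k
  haveI : Finite ψ'.ker := Finite.of_equiv _ e1
  calc Nat.card (N ⧸ (Ideal.span {((p : IwasawaAlgebra p)) ^ k} • (⊤ : Submodule (IwasawaAlgebra p) N)))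
      = Nat.card (CharacterModule ψ'.ker) := Nat.card_congr Ψ'.toEquiv
    _ = Nat.card ψ'.ker := natCard_characterModule_of_finite _
    _ = Nat.card {s : ψ.ker // p ^ k • s = 0} := Nat.card_congr e1.symm
    _ ≤ C * p ^ (k * r) := hle

/-! ## §3 The Selmer dual: `#Sel_∞[ψ_m, p^k] ≤ C p^{kr}` ⟹ `rank_{ℤ_p} X/q_m X ≤ r` -/

section Selmer

open WeierstrassCurve

universe u

variable {K : Type u} [Field K] [NumberField K] {W : WeierstrassCurve K} {κ : ZpExtension K p}
  {γ : Field.absoluteGaloisGroup K}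

/-- **(H-ii) at `q_m` as a COUNT.** For any Pontryagin-dual datum `D` of `Sel_∞ = Sel_{p^∞}(E/K_∞)` over `(κ, γ)` with `X = D.X` finitely
generated, `m ≥ 1`, `q_m = T^m + p`, `ψ_m = (conj_γ − 1)^m + p` on `Sel_∞`: if `{s ∈ Sel_∞ : ψ_m s = 0, p^k s = 0}` is finite with at most
`C · p^{k r}` elements for every `k`, then `lambdaInvariant p (X ⧸ q_m X) ≤ r` — the binder shape of the v9 stub's `hrank` (with `r = 1`,
`C` uniform in `m`: `≤ m + C′` after taking `r·m`… see `…_le_add`). [cite: GreenbergLNM1716, §4 p. 98] [cite: Howard2004HeegnerKolyvagin, Thm. 1.6.1, Lemma 2.2.7] -/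
theorem lambdaInvariant_quotient_qm_le_of_natCard_le (D : W.SelmerDualData κ γ) [Module.Finite (IwasawaAlgebra p) D.X]
    {m : ℕ} (hm : 1 ≤ m) (r C : ℕ)
    (hcount : ∀ k : ℕ,
      Finite {s : ((W.conjSelmerInfty κ γ - 1) ^ m + (p : AddMonoid.End (W.selmerInfty κ))).ker // p ^ k • s = 0} ∧
        Nat.card {s : ((W.conjSelmerInfty κ γ - 1) ^ m + (p : AddMonoid.End (W.selmerInfty κ))).ker // p ^ k • s = 0} ≤ C * p ^ (k * r)) :
    lambdaInvariant p (D.X ⧸ ((Ideal.span {(PowerSeries.X ^ m + PowerSeries.C (p : ℤ_[p]) : IwasawaAlgebra p)} :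
      Ideal (IwasawaAlgebra p)) • (⊤ : Submodule (IwasawaAlgebra p) D.X))) ≤ r :=
  lambdaInvariant_quotSMulTop_le_of_dual D.toDual D.bijective hm _ (D.toDual_qm_smul m) r C hcount

/-- **(H-ii) in the v9 stub's shape `≤ m + C`**: if for some `C` and every large `m` the counts satisfy
`#Sel_∞[ψ_m, p^k] ≤ p^{C} · p^{k m}` for all `k`, then `lambdaInvariant p (X ⧸ q_m X) ≤ m ≤ m + C′` for those `m` — in particular the
binder `∀ m₀, ∃ m ≥ m₀, lambdaInvariant p (X ⧸ q_m X) ≤ m + C′` of `stub_howardOutputsOfFamily` holds (with any `C′`).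
[cite: Howard2004HeegnerKolyvagin, Thm. 1.6.1 (ii), proof of Thm. 2.2.10] -/
theorem hrank_of_natCard_le (D : W.SelmerDualData κ γ) [Module.Finite (IwasawaAlgebra p) D.X] (C C' m₁ : ℕ)
    (hcount : ∀ m : ℕ, m₁ ≤ m → ∀ k : ℕ,
      Finite {s : ((W.conjSelmerInfty κ γ - 1) ^ m + (p : AddMonoid.End (W.selmerInfty κ))).ker // p ^ k • s = 0} ∧
        Nat.card {s : ((W.conjSelmerInfty κ γ - 1) ^ m + (p : AddMonoid.End (W.selmerInfty κ))).ker // p ^ k • s = 0} ≤ p ^ C * p ^ (k * m)) :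
    ∀ m₀ : ℕ, ∃ m : ℕ, m₀ ≤ m ∧
      lambdaInvariant p (D.X ⧸ ((Ideal.span {(PowerSeries.X ^ m + PowerSeries.C (p : ℤ_[p]) : IwasawaAlgebra p)} :
        Ideal (IwasawaAlgebra p)) • (⊤ : Submodule (IwasawaAlgebra p) D.X))) ≤ m + C' := by
  intro m₀
  refine ⟨max m₀ (max m₁ 1), le_max_left _ _, ?_⟩
  have hm1 : m₁ ≤ max m₀ (max m₁ 1) := le_trans (le_max_left _ _) (le_max_right _ _)
  have hone : 1 ≤ max m₀ (max m₁ 1) := le_trans (le_max_right _ _) (le_max_right _ _)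
  exact (lambdaInvariant_quotient_qm_le_of_natCard_le D hone _ (p ^ C) (hcount _ hm1)).trans (Nat.le_add_right _ _)

end Selmer

end Summit.BirchSwinnertonDyer.BirchSwinnertonDyer.Theorems.UniversalToricDescentEisensteinCorankReadoutDual

end
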